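import Literature.AnabelianGeometry.SemiGraphs.CoveringGraphEquiv
import Literature.AnabelianGeometry.SemiGraphs.TemperedCoveringsTemperedLimitsProofs
import HarnessLib

/-!
# The covering semi-graph of anabelioids: tempered objects on both sides

Mochizuki, *Semi-graphs of anabelioids*, Publ. RIMS **42** (2006) [cite: MochizukiSemiAnbd2006, §3
pp.37-40]. Along the equivalence `CovObj.toCovering S : B^cov(G)_S ⥤ B^cov(G_S)` of
`CoveringGraphEquiv`:

* (B) `isTempered_toCovering` — if `T → S` has `T` tempered over `G`, then its image is tempered over
  `G_S` (the finite étale covering splitting a component of `T` pulls back along `G_S → G` to one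
  splitting the corresponding component of the image): UNCONDITIONAL;
* (C) `isTempered_of_toCovering` — conversely, under the named fact `UniformSplitting` (the covering-
  construction sentence of the proof of Prop. 3.6 (v), p. 40) and for `G` as in Proposition 3.6,
  coherent, with `S` tempered: if the image of `T → S` is tempered over `G_S` then `T` is tempered
  over `G` (print's argument: a finite étale covering of `G` whose pull-back splits the splitting
  covering over `G_S`, times one splitting `S`, splits `T`).

Also: `isTempered_of_iso` (temperedness is invariant under isomorphism in `B^cov(G)`).
-/

noncomputable section

open CategoryTheory Topology

namespace Literature.AnabelianGeometry.SemiGraphs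

open Literature.AlgebraicGeometry.Frobenioids.QuasiTemperoid.BTempConnected (hom_ρ hom_ext_apply
  ρ_one_apply ρ_mul_apply ρ_inv_apply)
open GaloisObjects (comp_apply iso_inv_hom_apply iso_hom_inv_apply)

universe u

namespace ProfiniteSemiGraph

namespace CovObj

variable {𝒢 : ProfiniteSemiGraph.{u}}

/-! ### Temperedness is invariant under isomorphism -/

/-- The point map of a morphism of `B^cov(G)` (as in `TemperedCoveringsComponentsProofs`).
[cite: MochizukiSemiAnbd2006, Def 3.5(ii) p.37] -/
abbrev ptMap {T T' : CovObj 𝒢} (f : T ⟶ T') : T.Point → T'.Point :=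
  Sum.map (Sigma.map id fun v x => (f.fV v).hom.hom x) (Sigma.map id fun e x => (f.fE e).hom.hom x)

/-- `e.inv ∘ e.hom = id` on points. [cite: MochizukiSemiAnbd2006, Def 3.5(ii) p.37] -/
theorem ptMap_inv_hom {T T' : CovObj 𝒢} (e : T ≅ T') (p : T.Point) : ptMap e.inv (ptMap e.hom p) = p := by
  rcases p with ⟨v, x⟩ | ⟨e', x⟩
  · change (Sum.inl ⟨v, (e.inv.fV v).hom.hom ((e.hom.fV v).hom.hom x)⟩ : T.Point) = Sum.inl ⟨v, x⟩
    rw [← GaloisObjects.comp_apply, ← CovHom.comp_fV, e.hom_inv_id, CovHom.id_fV]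
    rfl
  · change (Sum.inr ⟨e', (e.inv.fE e').hom.hom ((e.hom.fE e').hom.hom x)⟩ : T.Point) = Sum.inr ⟨e', x⟩
    rw [← GaloisObjects.comp_apply, ← CovHom.comp_fE, e.hom_inv_id, CovHom.id_fE]
    rfl

/-- **Temperedness is invariant under isomorphism** in `B^cov(G)`. [cite: MochizukiSemiAnbd2006, Def 3.5(ii) p.37] -/
theorem isTempered_of_iso {T T' : CovObj 𝒢} (e : T ≅ T') (h : T'.IsTempered) : T.IsTempered := by
  intro p
  obtain ⟨F, hfin, hne, hsplit⟩ := h (ptMap e.hom p)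
  refine ⟨F, hfin, hne, fun q hq => ?_⟩
  have h1 : F.SplitsAt T' (ptMap e.hom q) := hsplit _ (sameComponent_map e.hom hq)
  have h2 : F.SplitsAt T (ptMap e.inv (ptMap e.hom q)) := splitsAt_map e.inv F h1
  rwa [ptMap_inv_hom] at h2

variable (S : CovObj 𝒢)

/-! ### (B) Tempered over `G` ⇒ tempered over `G_S` -/

/-- The point of `T` under a point of `toCovering T` (forget the base-point condition).
[cite: MochizukiSemiAnbd2006, Prop 3.6(v) p.39] -/
def ptDown (T : Over S) : (S.toCovering.obj T).Point → T.left.Point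
  | Sum.inl ⟨v', x⟩ => Sum.inl ⟨v'.1, x.1⟩
  | Sum.inr ⟨e', x⟩ => Sum.inr ⟨e'.1, x.1⟩

/-- Adjacent points of `toCovering T` lie over points of one component of `T`.
[cite: MochizukiSemiAnbd2006, Prop 3.6(v) p.39] -/
theorem sameComponent_ptDown_of_adj (T : Over S) {p q : (S.toCovering.obj T).Point}
    (h : (S.toCovering.obj T).Adj p q) : T.left.SameComponent (S.ptDown T p) (S.ptDown T q) := by
  cases h with
  | vertex v' k x => exact Relation.EqvGen.rel _ _ (Adj.vertex v'.1 (k : 𝒢.Gv v'.1) x.1)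
  | edge e' k x => exact Relation.EqvGen.rel _ _ (Adj.edge e'.1 (k : 𝒢.Ge e'.1) x.1)
  | glue b' v' h' x =>
    refine Relation.EqvGen.trans _ _ _
      (Relation.EqvGen.rel _ _ (Adj.glue b'.1 v'.1 (S.abuts_of_coveringAbuts h') x.1))
      (Relation.EqvGen.rel _ _ ?_)
    exact Adj.vertex v'.1 (S.conjugator (b := b'.1) (ω := b'.2) (v := v'.1) (ωv := v'.2) h') _

/-- Points of one component of `toCovering T` lie over points of one component of `T`.
[cite: MochizukiSemiAnbd2006, Prop 3.6(v) p.39] -/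
theorem sameComponent_ptDown (T : Over S) {p q : (S.toCovering.obj T).Point}
    (h : (S.toCovering.obj T).SameComponent p q) :
    T.left.SameComponent (S.ptDown T p) (S.ptDown T q) := by
  induction h with
  | rel a b hab => exact S.sameComponent_ptDown_of_adj T hab
  | refl a => exact Relation.EqvGen.refl _
  | symm a b _ ih => exact Relation.EqvGen.symm _ _ ih
  | trans a b c _ _ ih₁ ih₂ => exact Relation.EqvGen.trans _ _ _ ih₁ ih₂

/-- A finite covering of `G` splitting `T` at the underlying point pulls back along `G_S → G` to one
splitting `toCovering T` at the point. [cite: MochizukiSemiAnbd2006, Prop 3.6(v) p.39] -/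
theorem splitsAt_ptDown (T : Over S) (F : CovObj 𝒢) {q : (S.toCovering.obj T).Point}
    (h : F.SplitsAt T.left (S.ptDown T q)) :
    (S.coveringHom.covPullback.obj F).SplitsAt (S.toCovering.obj T) q := by
  rcases q with ⟨v', x⟩ | ⟨e', x⟩
  · exact fun y k hk => Subtype.ext (h y (k : 𝒢.Gv v'.1) hk)
  · exact fun y k hk => Subtype.ext (h y (k : 𝒢.Ge e'.1) hk)

/-- **(B) Tempered over `G` ⇒ tempered over `G_S`**: for `T → S` with `T` tempered, `toCovering T` is
a tempered object of `B^cov(G_S)` ("composites … with the given tempered covering", p. 40, easy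
direction). [cite: MochizukiSemiAnbd2006, Prop 3.6(v) p.40] -/
theorem isTempered_toCovering (T : Over S) (hT : T.left.IsTempered) :
    (S.toCovering.obj T).IsTempered := by
  intro p
  obtain ⟨F, hfin, hne, hsplit⟩ := hT (S.ptDown T p)
  exact ⟨S.coveringHom.covPullback.obj F, S.coveringHom.isFinite_covPullback hfin,
    S.coveringHom.hasNonemptyFibres_covPullback hne,
    fun q hq => S.splitsAt_ptDown T F (hsplit _ (S.sameComponent_ptDown T hq))⟩

/-! ### (C) Tempered over `G_S` ⇒ tempered over `G`, under `UniformSplitting` -/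

section Converse

variable (T : Over S)

/-- The base-fibre translate of a point of `T`: a point of `toCovering T`.
[cite: MochizukiSemiAnbd2006, Prop 3.6(v) p.40] -/
def ptUp : T.left.Point → (S.toCovering.obj T).Point
  | Sum.inl ⟨v, t⟩ => Sum.inl ⟨⟨v, BTemp.cl (S.SV v) ((T.hom.fV v).hom.hom t)⟩,
      BTemp.toBaseFibre ((S.postV v).obj T) t⟩
  | Sum.inr ⟨e, t⟩ => Sum.inr ⟨⟨e, BTemp.cl (S.SE e) ((T.hom.fE e).hom.hom t)⟩,
      BTemp.toBaseFibre ((S.postE e).obj T) t⟩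

/-- Any presentation `t = g · x` of a vertex point by a base-fibre point `x` gives a point of
`toCovering T` in the component of the base-fibre translate of `t`.
[cite: MochizukiSemiAnbd2006, Prop 3.6(v) p.40] -/
theorem sameComponent_ptUp_inl {v : 𝒢.graph.Vertex} (t : (T.left.SV v).obj.V)
    (ω : BTemp.Orbits (S.SV v)) (x : BTemp.PtFibre ((S.postV v).obj T) (Quot.out ω)) (g : 𝒢.Gv v)
    (hx : (T.left.SV v).obj.ρ g x.1 = t) :
    (S.toCovering.obj T).SameComponent (S.ptUp T (Sum.inl ⟨v, t⟩)) (Sum.inl ⟨⟨v, ω⟩, x⟩) := by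
  have hs : ((T.hom.fV v).hom.hom t : (S.SV v).obj.V) = (S.SV v).obj.ρ g (Quot.out ω) := by
    rw [← hx, hom_ρ]
    exact congrArg _ x.2
  have hω : BTemp.cl (S.SV v) ((T.hom.fV v).hom.hom t) = ω := by
    rw [hs, BTemp.cl_ρ]
    exact Quot.out_eq ω
  subst hω
  -- `k := γ⁻¹ g` stabilises the base point and carries `x` to `γ⁻¹ t`
  have hk : (S.SV v).obj.ρ ((BTemp.sec (S.SV v) ((T.hom.fV v).hom.hom t))⁻¹ * g)
      (Quot.out (BTemp.cl (S.SV v) ((T.hom.fV v).hom.hom t))) =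
      Quot.out (BTemp.cl (S.SV v) ((T.hom.fV v).hom.hom t)) := by
    rw [ρ_mul_apply, ← hs, BTemp.ρ_sec_inv]
  let k : BTemp.stab (S.SV v) (Quot.out (BTemp.cl (S.SV v) ((T.hom.fV v).hom.hom t))) := ⟨_, hk⟩
  have e : ((S.toCovering.obj T).SV ⟨v, BTemp.cl (S.SV v) ((T.hom.fV v).hom.hom t)⟩).obj.ρ k x =
      BTemp.toBaseFibre ((S.postV v).obj T) t := by
    apply Subtype.ext
    change (T.left.SV v).obj.ρ ((BTemp.sec (S.SV v) ((T.hom.fV v).hom.hom t))⁻¹ * g) x.1 =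
      (T.left.SV v).obj.ρ (BTemp.sec (S.SV v) ((T.hom.fV v).hom.hom t))⁻¹ t
    rw [ρ_mul_apply, hx]
  refine Relation.EqvGen.symm _ _ (Relation.EqvGen.rel _ _ ?_)
  have ha := Adj.vertex (S := S.toCovering.obj T) ⟨v, BTemp.cl (S.SV v) ((T.hom.fV v).hom.hom t)⟩ k x
  rw [e] at ha
  exact ha

/-- Edge version of `sameComponent_ptUp_inl`. [cite: MochizukiSemiAnbd2006, Prop 3.6(v) p.40] -/
theorem sameComponent_ptUp_inr {e : 𝒢.graph.Edge} (t : (T.left.SE e).obj.V)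
    (ω : BTemp.Orbits (S.SE e)) (x : BTemp.PtFibre ((S.postE e).obj T) (Quot.out ω)) (g : 𝒢.Ge e)
    (hx : (T.left.SE e).obj.ρ g x.1 = t) :
    (S.toCovering.obj T).SameComponent (S.ptUp T (Sum.inr ⟨e, t⟩)) (Sum.inr ⟨⟨e, ω⟩, x⟩) := by
  have hs : ((T.hom.fE e).hom.hom t : (S.SE e).obj.V) = (S.SE e).obj.ρ g (Quot.out ω) := by
    rw [← hx, hom_ρ]
    exact congrArg _ x.2
  have hω : BTemp.cl (S.SE e) ((T.hom.fE e).hom.hom t) = ω := by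
    rw [hs, BTemp.cl_ρ]
    exact Quot.out_eq ω
  subst hω
  have hk : (S.SE e).obj.ρ ((BTemp.sec (S.SE e) ((T.hom.fE e).hom.hom t))⁻¹ * g)
      (Quot.out (BTemp.cl (S.SE e) ((T.hom.fE e).hom.hom t))) =
      Quot.out (BTemp.cl (S.SE e) ((T.hom.fE e).hom.hom t)) := by
    rw [ρ_mul_apply, ← hs, BTemp.ρ_sec_inv]
  let k : BTemp.stab (S.SE e) (Quot.out (BTemp.cl (S.SE e) ((T.hom.fE e).hom.hom t))) := ⟨_, hk⟩
  have e1 : ((S.toCovering.obj T).SE ⟨e, BTemp.cl (S.SE e) ((T.hom.fE e).hom.hom t)⟩).obj.ρ k x =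
      BTemp.toBaseFibre ((S.postE e).obj T) t := by
    apply Subtype.ext
    change (T.left.SE e).obj.ρ ((BTemp.sec (S.SE e) ((T.hom.fE e).hom.hom t))⁻¹ * g) x.1 =
      (T.left.SE e).obj.ρ (BTemp.sec (S.SE e) ((T.hom.fE e).hom.hom t))⁻¹ t
    rw [ρ_mul_apply, hx]
  refine Relation.EqvGen.symm _ _ (Relation.EqvGen.rel _ _ ?_)
  have ha := Adj.edge (S := S.toCovering.obj T) ⟨e, BTemp.cl (S.SE e) ((T.hom.fE e).hom.hom t)⟩ k x
  rw [e1] at ha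
  exact ha

/-- `γ γ⁻¹ t = t`. [cite: MochizukiSemiAnbd2006, Prop 3.6(v) p.40] -/
theorem ρ_sec_toBaseFibre {G : Type u} [Group G] [TopologicalSpace G] {X : BTemp G} (U : Over X)
    (t : U.left.obj.V) :
    U.left.obj.ρ (BTemp.sec X (U.hom.hom.hom t)) (BTemp.toBaseFibre U t).1 = t := by
  change U.left.obj.ρ _ (U.left.obj.ρ _ t) = t
  rw [← ρ_mul_apply, mul_inv_cancel, ρ_one_apply]

/-- Adjacent points of `T` have base-fibre translates in one component of `toCovering T`.
[cite: MochizukiSemiAnbd2006, Prop 3.6(v) p.40] -/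
theorem sameComponent_ptUp_of_adj {p q : T.left.Point} (h : T.left.Adj p q) :
    (S.toCovering.obj T).SameComponent (S.ptUp T p) (S.ptUp T q) := by
  cases h with
  | vertex v g t =>
    -- `g t = (g γ) · (γ⁻¹ t)`
    refine Relation.EqvGen.symm _ _ (S.sameComponent_ptUp_inl T _ _ _
      (g * BTemp.sec (S.SV v) ((T.hom.fV v).hom.hom t)) ?_)
    rw [ρ_mul_apply]
    exact congrArg _ (ρ_sec_toBaseFibre ((S.postV v).obj T) t)
  | edge e g t =>
    refine Relation.EqvGen.symm _ _ (S.sameComponent_ptUp_inr T _ _ _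
      (g * BTemp.sec (S.SE e) ((T.hom.fE e).hom.hom t)) ?_)
    rw [ρ_mul_apply]
    exact congrArg _ (ρ_sec_toBaseFibre ((S.postE e).obj T) t)
  | glue b v hb t =>
    -- `t_e ~ glue'(x_e)` in `toCovering T` by the gluing along `(b, [s_e])`, then translate
    let s : (S.SE (𝒢.graph.edgeOf b)).obj.V := (T.hom.fE (𝒢.graph.edgeOf b)).hom.hom t
    let x := BTemp.toBaseFibre ((S.postE (𝒢.graph.edgeOf b)).obj T) t
    have h' := S.coveringAbuts_eq hb (BTemp.cl (S.SE (𝒢.graph.edgeOf b)) s)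
    have hadj := Adj.glue (S := S.toCovering.obj T) ⟨b, BTemp.cl (S.SE (𝒢.graph.edgeOf b)) s⟩
      ⟨v, S.glueOrbit b v hb (BTemp.cl (S.SE (𝒢.graph.edgeOf b)) s)⟩ h' x
    refine Relation.EqvGen.trans _ _ _ (Relation.EqvGen.rel _ _ hadj)
      (Relation.EqvGen.symm _ _ (S.sameComponent_ptUp_inl T _ _ _
        (𝒢.brHom b v hb (BTemp.sec (S.SE (𝒢.graph.edgeOf b)) s) * (S.conjugator h')⁻¹) ?_))
    -- `(b_* γ · c⁻¹) · (c · glue_T (γ⁻¹ t)) = glue_T t`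
    change (T.left.SV v).obj.ρ (𝒢.brHom b v hb (BTemp.sec (S.SE (𝒢.graph.edgeOf b)) s) * (S.conjugator h')⁻¹)
        ((T.left.SV v).obj.ρ (S.conjugator h')
          ((T.left.glue b v hb).hom.hom.hom x.1)) = (T.left.glue b v hb).hom.hom.hom t
    rw [← ρ_mul_apply, inv_mul_cancel_right, ← BTemp.res_obj_ρ_apply (𝒢.brHom b v hb) (T.left.SV v),
      ← hom_ρ]
    exact congrArg _ (ρ_sec_toBaseFibre ((S.postE (𝒢.graph.edgeOf b)).obj T) t)

/-- Points of one component of `T` have base-fibre translates in one component of `toCovering T`.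
[cite: MochizukiSemiAnbd2006, Prop 3.6(v) p.40] -/
theorem sameComponent_ptUp {p q : T.left.Point} (h : T.left.SameComponent p q) :
    (S.toCovering.obj T).SameComponent (S.ptUp T p) (S.ptUp T q) := by
  induction h with
  | rel a b hab => exact S.sameComponent_ptUp_of_adj T hab
  | refl a => exact Relation.EqvGen.refl _
  | symm a b _ ih => exact Relation.EqvGen.symm _ _ ih
  | trans a b c _ _ ih₁ ih₂ => exact Relation.EqvGen.trans _ _ _ ih₁ ih₂

/-! #### Carrying a component of a covering of `G_S` along a component of `T` -/

variable (F' : CovObj S.coveringGraph) (p₀ : F'.Point)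

/-- "The component of `p₀` in `F'` has a point over the vertex `v'` of `G_S`."
[cite: MochizukiSemiAnbd2006, Prop 3.6(v) p.40] -/
def MeetsV (v' : S.coveringGraph.graph.Vertex) : Prop :=
  ∃ y : (F'.SV v').obj.V, F'.SameComponent p₀ (Sum.inl ⟨v', y⟩)

/-- "The component of `p₀` in `F'` has a point over the edge `e'` of `G_S`."
[cite: MochizukiSemiAnbd2006, Prop 3.6(v) p.40] -/
def MeetsE (e' : S.coveringGraph.graph.Edge) : Prop :=
  ∃ y : (F'.SE e').obj.V, F'.SameComponent p₀ (Sum.inr ⟨e', y⟩)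

/-- Along a branch of `G_S` the component meets the edge iff it meets the vertex (the gluings are
bijections). [cite: MochizukiSemiAnbd2006, Prop 3.6(v) p.40] -/
theorem meetsE_iff_meetsV (b' : S.coveringGraph.graph.Branch) (v' : S.coveringGraph.graph.Vertex)
    (h' : S.coveringGraph.graph.abuts b' = some v') :
    S.MeetsE F' p₀ (S.coveringGraph.graph.edgeOf b') ↔ S.MeetsV F' p₀ v' := by
  constructor
  · rintro ⟨y, hy⟩
    exact ⟨_, Relation.EqvGen.trans _ _ _ hy (Relation.EqvGen.rel _ _ (Adj.glue b' v' h' y))⟩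
  · rintro ⟨y, hy⟩
    refine ⟨(F'.glue b' v' h').inv.hom.hom y, Relation.EqvGen.trans _ _ _ hy
      (Relation.EqvGen.symm _ _ ?_)⟩
    have ha := Adj.glue (S := F') b' v' h' ((F'.glue b' v' h').inv.hom.hom y)
    rw [glue_hom_inv_apply] at ha
    exact Relation.EqvGen.rel _ _ ha

/-- The index predicate: the component of `p₀` meets the vertex/edge of `G_S` under a point of
`toCovering T`. [cite: MochizukiSemiAnbd2006, Prop 3.6(v) p.40] -/
def Meets : (S.toCovering.obj T).Point → Prop
  | Sum.inl ⟨v', _⟩ => S.MeetsV F' p₀ v'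
  | Sum.inr ⟨e', _⟩ => S.MeetsE F' p₀ e'

/-- The index predicate is invariant along adjacency of `T` (consecutive indices coincide or are
joined by a branch of `G_S`). [cite: MochizukiSemiAnbd2006, Prop 3.6(v) p.40] -/
theorem meets_iff_of_adj {p q : T.left.Point} (h : T.left.Adj p q) :
    S.Meets T F' p₀ (S.ptUp T p) ↔ S.Meets T F' p₀ (S.ptUp T q) := by
  cases h with
  | vertex v g t =>
    change S.MeetsV F' p₀ ⟨v, BTemp.cl (S.SV v) ((T.hom.fV v).hom.hom t)⟩ ↔
      S.MeetsV F' p₀ ⟨v, BTemp.cl (S.SV v) ((T.hom.fV v).hom.hom ((T.left.SV v).obj.ρ g t))⟩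
    rw [hom_ρ, BTemp.cl_ρ]
  | edge e g t =>
    change S.MeetsE F' p₀ ⟨e, BTemp.cl (S.SE e) ((T.hom.fE e).hom.hom t)⟩ ↔
      S.MeetsE F' p₀ ⟨e, BTemp.cl (S.SE e) ((T.hom.fE e).hom.hom ((T.left.SE e).obj.ρ g t))⟩
    rw [hom_ρ, BTemp.cl_ρ]
  | glue b v hb t =>
    change S.MeetsE F' p₀ ⟨𝒢.graph.edgeOf b, BTemp.cl (S.SE _) ((T.hom.fE _).hom.hom t)⟩ ↔
      S.MeetsV F' p₀ ⟨v, BTemp.cl (S.SV v) ((T.hom.fV v).hom.hom ((T.left.glue b v hb).hom.hom.hom t))⟩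
    rw [← glue_hom_apply T.hom b v hb t]
    exact S.meetsE_iff_meetsV F' p₀ ⟨b, BTemp.cl (S.SE _) ((T.hom.fE _).hom.hom t)⟩ ⟨v, _⟩
      (S.coveringAbuts_eq hb _)

/-- The index predicate is constant on components of `T`. [cite: MochizukiSemiAnbd2006, Prop 3.6(v) p.40] -/
theorem meets_iff_of_sameComponent {p q : T.left.Point} (h : T.left.SameComponent p q) :
    S.Meets T F' p₀ (S.ptUp T p) ↔ S.Meets T F' p₀ (S.ptUp T q) := by
  induction h with
  | rel a b hab => exact S.meets_iff_of_adj T F' p₀ hab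
  | refl a => exact Iff.rfl
  | symm a b _ ih => exact ih.symm
  | trans a b c _ _ ih₁ ih₂ => exact ih₁.trans ih₂

/-! #### The splitting at a point -/

/-- The vertex case of the final verification: `F₀` splitting `S` at `s`, `F'` splitting
`toCovering T` at the translate of `t`, and `F₁` whose pull-back splits the component of `F'` over the
orbit of `s` together make any `P` dominating `F₀` and `F₁` split `T` at `t`.
[cite: MochizukiSemiAnbd2006, Prop 3.6(v) p.40] -/
theorem splitsAt_inl_of {v : 𝒢.graph.Vertex} (t : (T.left.SV v).obj.V) {F₀ F₁ P : CovObj 𝒢}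
    (π₀ : P ⟶ F₀) (π₁ : P ⟶ F₁)
    (h₀ : F₀.SplitsAt S (Sum.inl ⟨v, (T.hom.fV v).hom.hom t⟩))
    (hF' : F'.SplitsAt (S.toCovering.obj T) (S.ptUp T (Sum.inl ⟨v, t⟩)))
    (hm : S.Meets T F' p₀ (S.ptUp T (Sum.inl ⟨v, t⟩)))
    (h₁ : ∀ q, F'.SameComponent p₀ q → (S.coveringHom.covPullback.obj F₁).SplitsAt F' q) :
    P.SplitsAt T.left (Sum.inl ⟨v, t⟩) := by
  intro y g hy
  set s : (S.SV v).obj.V := (T.hom.fV v).hom.hom t with hs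
  set γ : 𝒢.Gv v := BTemp.sec (S.SV v) s with hγ
  -- `g` fixes `s`
  have hy₀ : (F₀.SV v).obj.ρ g ((π₀.fV v).hom.hom y) = (π₀.fV v).hom.hom y := by rw [← hom_ρ, hy]
  have hgs : (S.SV v).obj.ρ g s = s := h₀ _ g hy₀
  -- `k := γ⁻¹ g γ` stabilises the base point
  have hk : (S.SV v).obj.ρ (γ⁻¹ * g * γ) (Quot.out (BTemp.cl (S.SV v) s)) = Quot.out (BTemp.cl (S.SV v) s) := by
    rw [ρ_mul_apply, ρ_mul_apply, BTemp.ρ_sec, hgs, BTemp.ρ_sec_inv]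
  let k : BTemp.stab (S.SV v) (Quot.out (BTemp.cl (S.SV v) s)) := ⟨_, hk⟩
  -- `k` fixes a point `y'` of `F'` over `(v, [s])` in the component of `p₀`
  obtain ⟨y', hy'⟩ : S.MeetsV F' p₀ ⟨v, BTemp.cl (S.SV v) s⟩ := hm
  have hz : (F₁.SV v).obj.ρ (γ⁻¹ * g * γ) ((F₁.SV v).obj.ρ γ⁻¹ ((π₁.fV v).hom.hom y)) =
      (F₁.SV v).obj.ρ γ⁻¹ ((π₁.fV v).hom.hom y) := by
    rw [← ρ_mul_apply, mul_inv_cancel_right, ρ_mul_apply, ← hom_ρ, hy]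
  have hky' : (F'.SV ⟨v, BTemp.cl (S.SV v) s⟩).obj.ρ k y' = y' := h₁ _ hy' _ k hz
  -- hence `k` fixes the translate `γ⁻¹ t`
  have hkx := hF' y' k hky'
  have hkx' := congrArg Subtype.val hkx
  change (T.left.SV v).obj.ρ (γ⁻¹ * g * γ) ((T.left.SV v).obj.ρ γ⁻¹ t) = (T.left.SV v).obj.ρ γ⁻¹ t
    at hkx'
  rw [← ρ_mul_apply, mul_inv_cancel_right, ρ_mul_apply] at hkx'
  have := congrArg ((T.left.SV v).obj.ρ γ) hkx'
  rwa [← ρ_mul_apply, mul_inv_cancel, ρ_one_apply, ← ρ_mul_apply, mul_inv_cancel, ρ_one_apply] at this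

/-- The edge case of the final verification. [cite: MochizukiSemiAnbd2006, Prop 3.6(v) p.40] -/
theorem splitsAt_inr_of {e : 𝒢.graph.Edge} (t : (T.left.SE e).obj.V) {F₀ F₁ P : CovObj 𝒢}
    (π₀ : P ⟶ F₀) (π₁ : P ⟶ F₁)
    (h₀ : F₀.SplitsAt S (Sum.inr ⟨e, (T.hom.fE e).hom.hom t⟩))
    (hF' : F'.SplitsAt (S.toCovering.obj T) (S.ptUp T (Sum.inr ⟨e, t⟩)))
    (hm : S.Meets T F' p₀ (S.ptUp T (Sum.inr ⟨e, t⟩)))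
    (h₁ : ∀ q, F'.SameComponent p₀ q → (S.coveringHom.covPullback.obj F₁).SplitsAt F' q) :
    P.SplitsAt T.left (Sum.inr ⟨e, t⟩) := by
  intro y g hy
  set s : (S.SE e).obj.V := (T.hom.fE e).hom.hom t with hs
  set γ : 𝒢.Ge e := BTemp.sec (S.SE e) s with hγ
  have hy₀ : (F₀.SE e).obj.ρ g ((π₀.fE e).hom.hom y) = (π₀.fE e).hom.hom y := by rw [← hom_ρ, hy]
  have hgs : (S.SE e).obj.ρ g s = s := h₀ _ g hy₀
  have hk : (S.SE e).obj.ρ (γ⁻¹ * g * γ) (Quot.out (BTemp.cl (S.SE e) s)) = Quot.out (BTemp.cl (S.SE e) s) := by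
    rw [ρ_mul_apply, ρ_mul_apply, BTemp.ρ_sec, hgs, BTemp.ρ_sec_inv]
  let k : BTemp.stab (S.SE e) (Quot.out (BTemp.cl (S.SE e) s)) := ⟨_, hk⟩
  obtain ⟨y', hy'⟩ : S.MeetsE F' p₀ ⟨e, BTemp.cl (S.SE e) s⟩ := hm
  have hz : (F₁.SE e).obj.ρ (γ⁻¹ * g * γ) ((F₁.SE e).obj.ρ γ⁻¹ ((π₁.fE e).hom.hom y)) =
      (F₁.SE e).obj.ρ γ⁻¹ ((π₁.fE e).hom.hom y) := by
    rw [← ρ_mul_apply, mul_inv_cancel_right, ρ_mul_apply, ← hom_ρ, hy]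
  have hky' : (F'.SE ⟨e, BTemp.cl (S.SE e) s⟩).obj.ρ k y' = y' := h₁ _ hy' _ k hz
  have hkx := hF' y' k hky'
  have hkx' := congrArg Subtype.val hkx
  change (T.left.SE e).obj.ρ (γ⁻¹ * g * γ) ((T.left.SE e).obj.ρ γ⁻¹ t) = (T.left.SE e).obj.ρ γ⁻¹ t
    at hkx'
  rw [← ρ_mul_apply, mul_inv_cancel_right, ρ_mul_apply] at hkx'
  have := congrArg ((T.left.SE e).obj.ρ γ) hkx'
  rwa [← ρ_mul_apply, mul_inv_cancel, ρ_one_apply, ← ρ_mul_apply, mul_inv_cancel, ρ_one_apply] at this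

/-- A point of `F'` over the index of the base-fibre translate of `p` (nonempty fibres), so that the
index predicate holds at `p`. [cite: MochizukiSemiAnbd2006, Prop 3.6(v) p.40] -/
theorem exists_meets (hne : F'.HasNonemptyFibres) (p : T.left.Point) :
    ∃ p₀ : F'.Point, S.Meets T F' p₀ (S.ptUp T p) := by
  rcases p with ⟨v, t⟩ | ⟨e, t⟩
  · obtain ⟨y⟩ := hne.nonempty_V ⟨v, BTemp.cl (S.SV v) ((T.hom.fV v).hom.hom t)⟩
    exact ⟨Sum.inl ⟨_, y⟩, ⟨y, Relation.EqvGen.refl _⟩⟩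
  · obtain ⟨y⟩ := hne.nonempty_E ⟨e, BTemp.cl (S.SE e) ((T.hom.fE e).hom.hom t)⟩
    exact ⟨Sum.inr ⟨_, y⟩, ⟨y, Relation.EqvGen.refl _⟩⟩

end Converse

/-- **(C) Tempered over `G_S` ⇒ tempered over `G`, under `UniformSplitting`** (the converse half of
Prop. 3.6 (v), print's argument p. 40: the finite étale covering `F₁` of `G` produced by
`UniformSplitting` for the splitting covering `F'` over `G_S`, times a finite covering `F₀` splitting
`S`, splits `T`). [cite: MochizukiSemiAnbd2006, Prop 3.6(v) p.40] -/
theorem isTempered_of_toCovering (hU : UniformSplitting.{u}) (h36 : 𝒢.Prop36Hypotheses)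
    (hcoh : 𝒢.IsCoherent) (hS : S.IsTempered) (T : Over S)
    (hT' : (S.toCovering.obj T).IsTempered) : T.left.IsTempered := by
  intro p
  -- `F₀` splitting the component of `S` under `p`
  obtain ⟨F₀, h0fin, h0ne, h0split⟩ := hS (ptMap T.hom p)
  -- `F'` splitting the component of `toCovering T` at the translate of `p`
  obtain ⟨F', hF'fin, hF'ne, hF'split⟩ := hT' (S.ptUp T p)
  -- a point of `F'` over the index of the translate of `p`, and `F₁` from `UniformSplitting`
  obtain ⟨p₀, hp₀⟩ := S.exists_meets T F' hF'ne p
  obtain ⟨F₁, h1fin, h1ne, h1split⟩ := hU 𝒢 h36 hcoh S hS F' hF'fin p₀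
  -- a finite covering dominating `F₀` and `F₁`
  obtain ⟨P, π, hPfin, hPne⟩ := exists_finite_dominating ![F₀, F₁]
    (fun i => by fin_cases i <;> assumption) (fun i => by fin_cases i <;> assumption)
  refine ⟨P, hPfin, hPne, fun q hq => ?_⟩
  have hq₀ := h0split _ (sameComponent_map T.hom hq)
  have hq' := hF'split _ (S.sameComponent_ptUp T hq)
  have hqm := (S.meets_iff_of_sameComponent T F' p₀ hq).mp hp₀
  rcases q with ⟨v, t⟩ | ⟨e, t⟩
  · exact S.splitsAt_inl_of T F' p₀ t (π 0) (π 1) hq₀ hq' hqm h1split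
  · exact S.splitsAt_inr_of T F' p₀ t (π 0) (π 1) hq₀ hq' hqm h1split

end CovObj

end ProfiniteSemiGraph

end Literature.AnabelianGeometry.SemiGraphs

end
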